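import Mathlib
import HarnessLib
import Summits.HubbardSuperconductivity.HubbardSuperconductivity.Theorems.KLProgrammeC4aAbsBubbleDominatorIntegrable
import Summits.HubbardSuperconductivity.HubbardSuperconductivity.Theorems.KLProgrammeC4aAbsBubbleAngleLayerPh

/-!
# Route `KLProgramme` — crux C4a, S3 brick (B4)/(B5) «(B4)-DIRECT-PACK», part 8b: the θ-FREE POINTWISE DOMINATOR of the absolute bubble in the shape of
# `CoMovingJetsL1` — `a₀(ρ,ϑ) = K + P·log⁺(M/‖ϑ − π‖_𝕋)` (pp) / `K + P·log⁺(M/‖ϑ‖_𝕋)` (ph): pointwise bound, integrability on the chart box, uniform angular integral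

Cell `gate-hubbard-kl`, seat hubbard-kl-k3c3-p3 (g27; row «implicit-function / monotonicity route for μ(n)»).  Located brick for the (C)-closer lane
hubbard-kl-c4a-1 (stub (C) `stub_twoLeg_curvature` of `KLRegimeEngineV17F2`, stmt-HubbardSuperconductivity-20437), memo B4-DIRECT-PACK.md §6, and the interface
`…C4aCoMovingJetsL1.CoMovingJetsL1` (c4a-1): its dominators `a i : ℝ × ℝ → ℝ` must be θ-FREE, integrable on `(−r,r) ×ˢ (0,2π]`, with `∫_{(0,2π]} a i (ρ,ϑ) dϑ ≤ M_i`
uniformly in `ρ` (`setIntegral_box_norm_mul_le_of_unif`).  Part 6 proved such a bound INSIDE its proof; this file exposes it: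
* §1 **`absBubble_partnerBand_le_posLog`** (pp): for every `ϑ` with `‖ϑ − π‖_𝕋 > 0`, `F(ϑ;ρ,θ) ≤ K_T + K_C + W(b−a)·log⁺((πhi/(ĉ₀u_min))/‖ϑ − π‖_𝕋)` — the right side
  does not depend on `θ`, `ρ`, `lo`; **`absBubble_partnerBand_ph_le_posLog`** (ph, `‖ϑ‖_𝕋 > 0`).
* integrability on `(0,2π]` / on the chart box and the angular integrals `≤ 2π(K + P(1 + log⁺(M/π)))` are part 8a (`…C4aAbsBubbleDominatorIntegrable`).
So `a₀(ρ,ϑ) := K_T + K_C + W(b−a)·log⁺(M/‖ϑ−π‖_𝕋)` is an admissible `CoMovingJetsL1` dominator for the absolute pp bubble at `k = 0` (ph: `‖ϑ‖_𝕋`), with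
`M₀ = 2π(K_T + K_C + W(b−a)(1 + log⁺(M/π)))`.  Nothing asserts (C), K3 or superconductivity.
References: Salmhofer 1999 §4.5.3 Cor. 4.11 [cite: Salmhofer1999]; FST II CPAM 51 (1998) §3 [cite: FeldmanSalmhoferTrubowitz1998]; BGM 2006 §2.4 (2.36)
[cite: BenfattoGiulianiMastropietro2006].
-/

noncomputable section

namespace Summit.HubbardSuperconductivity.HubbardSuperconductivity.Theorems.C4a

set_option linter.dupNamespace false -- summit = problem name (single-conjunct summit), D-0017

open Real Set MeasureTheory
open Literature.MathematicalPhysics.QuantumLattice Literature.MathematicalPhysics.QuantumLattice.BandSectorCounting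
open Literature.MathematicalPhysics.QuantumLattice.FermiRG
open Summit.HubbardSuperconductivity.HubbardSuperconductivity.Theorems.KLRegimeSplit
open Summit.HubbardSuperconductivity.HubbardSuperconductivity.Theorems.DispersionFlow
open Summit.HubbardSuperconductivity.HubbardSuperconductivity.Theorems.PerturbedFermiCurve

section Sizes

variable {K : TrigPolyC4v} {A : ℝ} (hA : ∀ p : Momentum, ∀ j ≤ 2, ‖iteratedFDeriv ℝ j (frameShift K) p‖ ≤ A) (hA20 : A ≤ 1 / 20)
  (hd : klCurveD ≤ (bandBounds (show (-4 : ℝ) < -1.1 by norm_num) (show (-1.1 : ℝ) ≤ -0.1 by norm_num)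
    (show (-0.1 : ℝ) < 0 by norm_num)).Dtmin - 2 * A)
  {μ r : ℝ} (hr : 0 < r) (hlo : (-1.1 : ℝ) < μ - r - A) (hhi : μ + r + A < -0.1)
  {A₃ A₄ : ℝ} (hA₃ : ∀ p : Momentum, ‖iteratedFDeriv ℝ 3 (frameShift K) p‖ ≤ A₃)
  (hA₄ : ∀ p : Momentum, ‖iteratedFDeriv ℝ 4 (frameShift K) p‖ ≤ A₄)
  {K₁ K₂ K₃ : ℝ} (hK₁ : ∀ p : Momentum, ‖fderiv ℝ (frameLevel μ K) p‖ ≤ K₁) (hK₂ : ∀ p : Momentum, ‖iteratedFDeriv ℝ 2 (frameLevel μ K) p‖ ≤ K₂)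
  (hK₃ : ∀ p : Momentum, ‖iteratedFDeriv ℝ 3 (frameLevel μ K) p‖ ≤ K₃)
include hA hA20 hd hr hlo hhi hA₃ hA₄ hK₁ hK₂ hK₃

/-! ## §1 The θ-free pointwise dominators -/

/-- **THE θ-FREE POINTWISE DOMINATOR (pp)**: under part 6's hypotheses, for every tube angle with `‖ϑ − π‖_𝕋 > 0`,
`F(ϑ;ρ,θ) ≤ K_T + K_C + W(b−a)·log⁺((πhi/(ĉ₀u_min))/‖ϑ − π‖_𝕋)` — the `k = 0` dominator `a₀(ρ,ϑ)` of `CoMovingJetsL1` for the absolute pp bubble.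
[cite: Salmhofer1999, §4.5.3 Cor. 4.11] -/
theorem absBubble_partnerBand_le_posLog {Kc r₀ g₀ w : ℝ} (hG : GeomConstants (frameLevel μ K) Kc r₀ g₀ w) (hK₁0 : 0 < K₁) (hK₂0 : 0 < K₂)
    {ρ θ a b lo hi W c₀ c₁ sC d₁ κ : ℝ} {t wt : ℝ → ℝ} {NC NT : ℕ} (hρ : |ρ| < r)
    (hab : a ≤ b) (hlo0 : 0 < lo) (hlohi : lo ≤ hi) (hhir₀ : hi < r₀)
    (hc₀ : 0 < c₀) (hc₁ : 0 < c₁)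
    (hX : ((msD A₃ A₄ 1 *
            ((π / 2 * c₁ /
                  (((bandBounds (show (-4 : ℝ) < -1.1 by norm_num) (show (-1.1 : ℝ) ≤ -0.1 by norm_num) (show (-0.1 : ℝ) < 0 by norm_num)).Dtmin -
                      2 * A) *
                    (bandBounds (show (-4 : ℝ) < -1.1 by norm_num) (show (-1.1 : ℝ) ≤ -0.1 by norm_num) (show (-0.1 : ℝ) < 0 by norm_num)).umin) +
                π * Kc * c₀ / ((bandBounds (show (-4 : ℝ) < -1.1 by norm_num) (show (-1.1 : ℝ) ≤ -0.1 by norm_num) (show (-0.1 : ℝ) < 0 by norm_num)).Dtmin - 2 * A) ^ 2) /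
              ((bandBounds (show (-4 : ℝ) < -1.1 by norm_num) (show (-1.1 : ℝ) ≤ -0.1 by norm_num) (show (-0.1 : ℝ) < 0 by norm_num)).umin * w /
                (4 + 2 * A)))) +
          c₀ / ((bandBounds (show (-4 : ℝ) < -1.1 by norm_num) (show (-1.1 : ℝ) ≤ -0.1 by norm_num) (show (-0.1 : ℝ) < 0 by norm_num)).Dtmin - 2 * A)) < 1)
    (hwinC : sC * ((msD A₃ A₄ 1 *
            ((π / 2 * c₁ /
                  (((bandBounds (show (-4 : ℝ) < -1.1 by norm_num) (show (-1.1 : ℝ) ≤ -0.1 by norm_num) (show (-0.1 : ℝ) < 0 by norm_num)).Dtmin -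
                      2 * A) *
                    (bandBounds (show (-4 : ℝ) < -1.1 by norm_num) (show (-1.1 : ℝ) ≤ -0.1 by norm_num) (show (-0.1 : ℝ) < 0 by norm_num)).umin) +
                π * Kc * c₀ / ((bandBounds (show (-4 : ℝ) < -1.1 by norm_num) (show (-1.1 : ℝ) ≤ -0.1 by norm_num) (show (-0.1 : ℝ) < 0 by norm_num)).Dtmin - 2 * A) ^ 2) /
              ((bandBounds (show (-4 : ℝ) < -1.1 by norm_num) (show (-1.1 : ℝ) ≤ -0.1 by norm_num) (show (-0.1 : ℝ) < 0 by norm_num)).umin * w /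
                (4 + 2 * A)))) +
          c₀ / ((bandBounds (show (-4 : ℝ) < -1.1 by norm_num) (show (-1.1 : ℝ) ≤ -0.1 by norm_num) (show (-0.1 : ℝ) < 0 by norm_num)).Dtmin - 2 * A)) +
          2 * hi / ((bandBounds (show (-4 : ℝ) < -1.1 by norm_num) (show (-1.1 : ℝ) ≤ -0.1 by norm_num) (show (-0.1 : ℝ) < 0 by norm_num)).Dtmin - 2 * A) + sC < 3 / 5)
    (hwinC' : sC * ((msD A₃ A₄ 1 *
            ((π / 2 * c₁ /
                  (((bandBounds (show (-4 : ℝ) < -1.1 by norm_num) (show (-1.1 : ℝ) ≤ -0.1 by norm_num) (show (-0.1 : ℝ) < 0 by norm_num)).Dtmin -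
                      2 * A) *
                    (bandBounds (show (-4 : ℝ) < -1.1 by norm_num) (show (-1.1 : ℝ) ≤ -0.1 by norm_num) (show (-0.1 : ℝ) < 0 by norm_num)).umin) +
                π * Kc * c₀ / ((bandBounds (show (-4 : ℝ) < -1.1 by norm_num) (show (-1.1 : ℝ) ≤ -0.1 by norm_num) (show (-0.1 : ℝ) < 0 by norm_num)).Dtmin - 2 * A) ^ 2) /
              ((bandBounds (show (-4 : ℝ) < -1.1 by norm_num) (show (-1.1 : ℝ) ≤ -0.1 by norm_num) (show (-0.1 : ℝ) < 0 by norm_num)).umin * w /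
                (4 + 2 * A)))) +
          c₀ / ((bandBounds (show (-4 : ℝ) < -1.1 by norm_num) (show (-1.1 : ℝ) ≤ -0.1 by norm_num) (show (-0.1 : ℝ) < 0 by norm_num)).Dtmin - 2 * A)) +
          2 * hi / ((bandBounds (show (-4 : ℝ) < -1.1 by norm_num) (show (-1.1 : ℝ) ≤ -0.1 by norm_num) (show (-0.1 : ℝ) < 0 by norm_num)).Dtmin - 2 * A) + sC <
        2 * (bandBounds (show (-4 : ℝ) < -1.1 by norm_num) (show (-1.1 : ℝ) ≤ -0.1 by norm_num) (show (-0.1 : ℝ) < 0 by norm_num)).umin)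
    (hhirC : hi + c₀ * sC < r) (hNC : (b - a) * (4 * (K₂ * msD A₃ A₄ 1)) ≤ NC * c₀)
    (hd₁ : 0 < d₁) (hκ : 0 < κ)
    (hs₀ : ((msD A₃ A₄ 1 *
            ((π / 2 * d₁ /
                  (((bandBounds (show (-4 : ℝ) < -1.1 by norm_num) (show (-1.1 : ℝ) ≤ -0.1 by norm_num) (show (-0.1 : ℝ) < 0 by norm_num)).Dtmin -
                      2 * A) *
                    (bandBounds (show (-4 : ℝ) < -1.1 by norm_num) (show (-1.1 : ℝ) ≤ -0.1 by norm_num) (show (-0.1 : ℝ) < 0 by norm_num)).umin) +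
                π * Kc * κ / ((bandBounds (show (-4 : ℝ) < -1.1 by norm_num) (show (-1.1 : ℝ) ≤ -0.1 by norm_num) (show (-0.1 : ℝ) < 0 by norm_num)).Dtmin - 2 * A) ^ 2) /
              ((bandBounds (show (-4 : ℝ) < -1.1 by norm_num) (show (-1.1 : ℝ) ≤ -0.1 by norm_num) (show (-0.1 : ℝ) < 0 by norm_num)).umin * w /
                (4 + 2 * A)))) +
          κ / ((bandBounds (show (-4 : ℝ) < -1.1 by norm_num) (show (-1.1 : ℝ) ≤ -0.1 by norm_num) (show (-0.1 : ℝ) < 0 by norm_num)).Dtmin - 2 * A)) ≤ sC)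
    (hs₀' : ((msD A₃ A₄ 1 *
            ((π / 2 * d₁ /
                  (((bandBounds (show (-4 : ℝ) < -1.1 by norm_num) (show (-1.1 : ℝ) ≤ -0.1 by norm_num) (show (-0.1 : ℝ) < 0 by norm_num)).Dtmin -
                      2 * A) *
                    (bandBounds (show (-4 : ℝ) < -1.1 by norm_num) (show (-1.1 : ℝ) ≤ -0.1 by norm_num) (show (-0.1 : ℝ) < 0 by norm_num)).umin) +
                π * Kc * κ / ((bandBounds (show (-4 : ℝ) < -1.1 by norm_num) (show (-1.1 : ℝ) ≤ -0.1 by norm_num) (show (-0.1 : ℝ) < 0 by norm_num)).Dtmin - 2 * A) ^ 2) /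
              ((bandBounds (show (-4 : ℝ) < -1.1 by norm_num) (show (-1.1 : ℝ) ≤ -0.1 by norm_num) (show (-0.1 : ℝ) < 0 by norm_num)).umin * w /
                (4 + 2 * A)))) +
          κ / ((bandBounds (show (-4 : ℝ) < -1.1 by norm_num) (show (-1.1 : ℝ) ≤ -0.1 by norm_num) (show (-0.1 : ℝ) < 0 by norm_num)).Dtmin - 2 * A)) ≤ 3 / 5)
    (hhirT : hi + κ < r)
    (hsmall :
        K₃ * ((msD A₃ A₄ 1 *
            ((π / 2 * d₁ /
                  (((bandBounds (show (-4 : ℝ) < -1.1 by norm_num) (show (-1.1 : ℝ) ≤ -0.1 by norm_num) (show (-0.1 : ℝ) < 0 by norm_num)).Dtmin -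
                      2 * A) *
                    (bandBounds (show (-4 : ℝ) < -1.1 by norm_num) (show (-1.1 : ℝ) ≤ -0.1 by norm_num) (show (-0.1 : ℝ) < 0 by norm_num)).umin) +
                π * Kc * κ / ((bandBounds (show (-4 : ℝ) < -1.1 by norm_num) (show (-1.1 : ℝ) ≤ -0.1 by norm_num) (show (-0.1 : ℝ) < 0 by norm_num)).Dtmin - 2 * A) ^ 2) /
              ((bandBounds (show (-4 : ℝ) < -1.1 by norm_num) (show (-1.1 : ℝ) ≤ -0.1 by norm_num) (show (-0.1 : ℝ) < 0 by norm_num)).umin * w /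
                (4 + 2 * A)))) +
          (2 * hi + κ) / ((bandBounds (show (-4 : ℝ) < -1.1 by norm_num) (show (-1.1 : ℝ) ≤ -0.1 by norm_num) (show (-0.1 : ℝ) < 0 by norm_num)).Dtmin - 2 * A) +
              hi / ((bandBounds (show (-4 : ℝ) < -1.1 by norm_num) (show (-1.1 : ℝ) ≤ -0.1 by norm_num) (show (-0.1 : ℝ) < 0 by norm_num)).Dtmin - 2 * A)) *
            msD A₃ A₄ 1 ^ 2 +
          K₂ * (radialRowOneConst A ((bandBounds (show (-4 : ℝ) < -1.1 by norm_num) (show (-1.1 : ℝ) ≤ -0.1 by norm_num) (show (-0.1 : ℝ) < 0 by norm_num)).Dtmin -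
                2 * A) * hi) * (msD A₃ A₄ 1 + msD A₃ A₄ 1) +
          K₂ * ((msD A₃ A₄ 1 *
            ((π / 2 * d₁ /
                  (((bandBounds (show (-4 : ℝ) < -1.1 by norm_num) (show (-1.1 : ℝ) ≤ -0.1 by norm_num) (show (-0.1 : ℝ) < 0 by norm_num)).Dtmin -
                      2 * A) *
                    (bandBounds (show (-4 : ℝ) < -1.1 by norm_num) (show (-1.1 : ℝ) ≤ -0.1 by norm_num) (show (-0.1 : ℝ) < 0 by norm_num)).umin) +
                π * Kc * κ / ((bandBounds (show (-4 : ℝ) < -1.1 by norm_num) (show (-1.1 : ℝ) ≤ -0.1 by norm_num) (show (-0.1 : ℝ) < 0 by norm_num)).Dtmin - 2 * A) ^ 2) /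
              ((bandBounds (show (-4 : ℝ) < -1.1 by norm_num) (show (-1.1 : ℝ) ≤ -0.1 by norm_num) (show (-0.1 : ℝ) < 0 by norm_num)).umin * w /
                (4 + 2 * A)))) +
          (2 * hi + κ) / ((bandBounds (show (-4 : ℝ) < -1.1 by norm_num) (show (-1.1 : ℝ) ≤ -0.1 by norm_num) (show (-0.1 : ℝ) < 0 by norm_num)).Dtmin - 2 * A) +
              hi / ((bandBounds (show (-4 : ℝ) < -1.1 by norm_num) (show (-1.1 : ℝ) ≤ -0.1 by norm_num) (show (-0.1 : ℝ) < 0 by norm_num)).Dtmin - 2 * A)) *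
            msD A₃ A₄ 2 +
          K₁ * ((uRowTwoConst A A₃ ((bandBounds (show (-4 : ℝ) < -1.1 by norm_num) (show (-1.1 : ℝ) ≤ -0.1 by norm_num) (show (-0.1 : ℝ) < 0 by norm_num)).Dtmin -
                  2 * A) +
                1 / ((bandBounds (show (-4 : ℝ) < -1.1 by norm_num) (show (-1.1 : ℝ) ≤ -0.1 by norm_num) (show (-0.1 : ℝ) < 0 by norm_num)).Dtmin - 2 * A) +
                2 * (radialRowOneConst A ((bandBounds (show (-4 : ℝ) < -1.1 by norm_num) (show (-1.1 : ℝ) ≤ -0.1 by norm_num) (show (-0.1 : ℝ) < 0 by norm_num)).Dtmin - 2 * A) -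
                  1 / ((bandBounds (show (-4 : ℝ) < -1.1 by norm_num) (show (-1.1 : ℝ) ≤ -0.1 by norm_num) (show (-0.1 : ℝ) < 0 by norm_num)).Dtmin - 2 * A))) *
              hi) ≤
        w * (bandBounds (show (-4 : ℝ) < -1.1 by norm_num) (show (-1.1 : ℝ) ≤ -0.1 by norm_num) (show (-0.1 : ℝ) < 0 by norm_num)).umin ^ 2)
    (hNT : (b - a) * (4 * (K₁ * msD A₃ A₄ 1)) ≤ NT * κ) (hNT' : (b - a) * (4 * (K₂ * msD A₃ A₄ 1 ^ 2 + K₁ * msD A₃ A₄ 2)) ≤ NT * d₁)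
    (ht : ∀ e ∈ Icc lo hi, e ≤ t e) (hW : 0 ≤ W) (hw0 : ∀ e ∈ Icc lo hi, 0 ≤ wt e) (hw : ∀ e ∈ Icc lo hi, wt e ≤ W)
    {ϑ : ℝ} (hϑ : 0 < torusDist (ϑ - π)) :
    (∫ e in lo..hi, wt e * ∫ x in Icc a b, (max (t e) |frameLevel μ K (pairSumPath μ K ρ ϑ θ 0 - levelPoint μ K e (x + θ))|)⁻¹) ≤
      (W * ((4 * (b - a) / κ + 2 * (NT * (4 / d₁))) * (κ / 2) +
          2 * (12 * NT / Real.sqrt (w * (bandBounds (show (-4 : ℝ) < -1.1 by norm_num) (show (-1.1 : ℝ) ≤ -0.1 by norm_num) (show (-0.1 : ℝ) < 0 by norm_num)).umin ^ 2)) * Real.sqrt (κ / 2) + (b - a) * log⁺ (hi / (κ / 2)))) + (W * (2 * (b - a) + 2 * (NC * c₀ / c₁))) +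
        (W * (b - a)) * log⁺ ((π * hi / (c₀ * (bandBounds (show (-4 : ℝ) < -1.1 by norm_num) (show (-1.1 : ℝ) ≤ -0.1 by norm_num) (show (-0.1 : ℝ) < 0 by norm_num)).umin)) / torusDist (ϑ - π)) := by
  have hM := msD_one_pos A₃ A₄
  have hupos := (bandBounds (show (-4 : ℝ) < -1.1 by norm_num) (show (-1.1 : ℝ) ≤ -0.1 by norm_num) (show (-0.1 : ℝ) < 0 by norm_num)).umin_pos
  have hwpos := hG.wmin_pos
  have hDt : 0 < (bandBounds (show (-4 : ℝ) < -1.1 by norm_num) (show (-1.1 : ℝ) ≤ -0.1 by norm_num) (show (-0.1 : ℝ) < 0 by norm_num)).Dtmin - 2 * A := by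
    have := klCurveD_pos; linarith
  have hA0 : 0 ≤ A := (norm_nonneg _).trans (hA 0 0 (by norm_num))
  have hKc : 0 ≤ Kc := le_trans (norm_nonneg _) (hG.norm_iteratedFDeriv_le (0 : Momentum) 0 (by norm_num))
  have hposlog : ∀ y : ℝ, 0 ≤ log⁺ y := fun y => Real.posLog_nonneg
  have hKT0 : 0 ≤ (W * ((4 * (b - a) / κ + 2 * (NT * (4 / d₁))) * (κ / 2) +
          2 * (12 * NT / Real.sqrt (w * (bandBounds (show (-4 : ℝ) < -1.1 by norm_num) (show (-1.1 : ℝ) ≤ -0.1 by norm_num) (show (-0.1 : ℝ) < 0 by norm_num)).umin ^ 2)) * Real.sqrt (κ / 2) + (b - a) * log⁺ (hi / (κ / 2)))) := by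
    have := hposlog (hi / (κ / 2))
    positivity
  have hKC0 : 0 ≤ (W * (2 * (b - a) + 2 * (NC * c₀ / c₁))) := by positivity
  have hP0 : 0 ≤ (W * (b - a)) := mul_nonneg hW (by linarith)
  have hX0 : 0 ≤ ((msD A₃ A₄ 1 *
            ((π / 2 * c₁ /
                  (((bandBounds (show (-4 : ℝ) < -1.1 by norm_num) (show (-1.1 : ℝ) ≤ -0.1 by norm_num) (show (-0.1 : ℝ) < 0 by norm_num)).Dtmin -
                      2 * A) *
                    (bandBounds (show (-4 : ℝ) < -1.1 by norm_num) (show (-1.1 : ℝ) ≤ -0.1 by norm_num) (show (-0.1 : ℝ) < 0 by norm_num)).umin) +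
                π * Kc * c₀ / ((bandBounds (show (-4 : ℝ) < -1.1 by norm_num) (show (-1.1 : ℝ) ≤ -0.1 by norm_num) (show (-0.1 : ℝ) < 0 by norm_num)).Dtmin - 2 * A) ^ 2) /
              ((bandBounds (show (-4 : ℝ) < -1.1 by norm_num) (show (-1.1 : ℝ) ≤ -0.1 by norm_num) (show (-0.1 : ℝ) < 0 by norm_num)).umin * w /
                (4 + 2 * A)))) +
          c₀ / ((bandBounds (show (-4 : ℝ) < -1.1 by norm_num) (show (-1.1 : ℝ) ≤ -0.1 by norm_num) (show (-0.1 : ℝ) < 0 by norm_num)).Dtmin - 2 * A)) := by positivity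
  -- the chord is positive
  have hch := torusDist_sub_pi_le_norm_pairSum hA hr hlo hhi hρ ϑ θ
  have hs : 0 < ‖pairSumPath μ K ρ ϑ θ 0‖ := lt_of_lt_of_le (by positivity) hch
  by_cases hsle : ‖pairSumPath μ K ρ ϑ θ 0‖ ≤ sC
  · -- COOPER CLASS (part 3 §3) + the log of the chord is a log of the tube angle (part 3 §4)
    have hwin : ‖pairSumPath μ K ρ ϑ θ 0‖ * ((msD A₃ A₄ 1 *
            ((π / 2 * c₁ /
                  (((bandBounds (show (-4 : ℝ) < -1.1 by norm_num) (show (-1.1 : ℝ) ≤ -0.1 by norm_num) (show (-0.1 : ℝ) < 0 by norm_num)).Dtmin -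
                      2 * A) *
                    (bandBounds (show (-4 : ℝ) < -1.1 by norm_num) (show (-1.1 : ℝ) ≤ -0.1 by norm_num) (show (-0.1 : ℝ) < 0 by norm_num)).umin) +
                π * Kc * c₀ / ((bandBounds (show (-4 : ℝ) < -1.1 by norm_num) (show (-1.1 : ℝ) ≤ -0.1 by norm_num) (show (-0.1 : ℝ) < 0 by norm_num)).Dtmin - 2 * A) ^ 2) /
              ((bandBounds (show (-4 : ℝ) < -1.1 by norm_num) (show (-1.1 : ℝ) ≤ -0.1 by norm_num) (show (-0.1 : ℝ) < 0 by norm_num)).umin * w /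
                (4 + 2 * A)))) +
          c₀ / ((bandBounds (show (-4 : ℝ) < -1.1 by norm_num) (show (-1.1 : ℝ) ≤ -0.1 by norm_num) (show (-0.1 : ℝ) < 0 by norm_num)).Dtmin - 2 * A)) +
        2 * hi / ((bandBounds (show (-4 : ℝ) < -1.1 by norm_num) (show (-1.1 : ℝ) ≤ -0.1 by norm_num) (show (-0.1 : ℝ) < 0 by norm_num)).Dtmin - 2 * A) + ‖pairSumPath μ K ρ ϑ θ 0‖ < 3 / 5 := by
      have h1 := mul_le_mul_of_nonneg_right hsle hX0
      linarith
    have hwin' : ‖pairSumPath μ K ρ ϑ θ 0‖ * ((msD A₃ A₄ 1 *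
            ((π / 2 * c₁ /
                  (((bandBounds (show (-4 : ℝ) < -1.1 by norm_num) (show (-1.1 : ℝ) ≤ -0.1 by norm_num) (show (-0.1 : ℝ) < 0 by norm_num)).Dtmin -
                      2 * A) *
                    (bandBounds (show (-4 : ℝ) < -1.1 by norm_num) (show (-1.1 : ℝ) ≤ -0.1 by norm_num) (show (-0.1 : ℝ) < 0 by norm_num)).umin) +
                π * Kc * c₀ / ((bandBounds (show (-4 : ℝ) < -1.1 by norm_num) (show (-1.1 : ℝ) ≤ -0.1 by norm_num) (show (-0.1 : ℝ) < 0 by norm_num)).Dtmin - 2 * A) ^ 2) /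
              ((bandBounds (show (-4 : ℝ) < -1.1 by norm_num) (show (-1.1 : ℝ) ≤ -0.1 by norm_num) (show (-0.1 : ℝ) < 0 by norm_num)).umin * w /
                (4 + 2 * A)))) +
          c₀ / ((bandBounds (show (-4 : ℝ) < -1.1 by norm_num) (show (-1.1 : ℝ) ≤ -0.1 by norm_num) (show (-0.1 : ℝ) < 0 by norm_num)).Dtmin - 2 * A)) +
        2 * hi / ((bandBounds (show (-4 : ℝ) < -1.1 by norm_num) (show (-1.1 : ℝ) ≤ -0.1 by norm_num) (show (-0.1 : ℝ) < 0 by norm_num)).Dtmin - 2 * A) + ‖pairSumPath μ K ρ ϑ θ 0‖ <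
      2 * (bandBounds (show (-4 : ℝ) < -1.1 by norm_num) (show (-1.1 : ℝ) ≤ -0.1 by norm_num) (show (-0.1 : ℝ) < 0 by norm_num)).umin := by
      have h1 := mul_le_mul_of_nonneg_right hsle hX0
      linarith
    have hhir' : hi + c₀ * ‖pairSumPath μ K ρ ϑ θ 0‖ < r := by
      have h2 := mul_le_mul_of_nonneg_left hsle hc₀.le
      linarith
    have hCoop := level_loop_partnerBand_le_cooper_chord hA hA20 hd hlo hhi hA₃ hA₄ hK₂ hG hK₂0 (ϑ := ϑ) (θ := θ) (t := t) (wt := wt) hab hlo0 hlohi hhir₀ hhir'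
      hc₀ hc₁ hs hX hwin hwin' hNC ht hW hw0 hw
    have hlog := posLog_chord_le_posLog_torusDist hA hr hlo hhi hρ (ϑ := ϑ) (θ := θ) (hi := hi) (by linarith) hc₀ hϑ
    have hPl := mul_le_mul_of_nonneg_left hlog hP0
    calc (∫ e in lo..hi, wt e * ∫ x in Icc a b, (max (t e) |frameLevel μ K (pairSumPath μ K ρ ϑ θ 0 - levelPoint μ K e (x + θ))|)⁻¹)
        ≤ W * (2 * (b - a) + 2 * (NC * c₀ / c₁) + (b - a) * log⁺ (hi / (c₀ * ‖pairSumPath μ K ρ ϑ θ 0‖ / 2))) := hCoop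
      _ = (W * (2 * (b - a) + 2 * (NC * c₀ / c₁))) + (W * (b - a)) * log⁺ (hi / (c₀ * ‖pairSumPath μ K ρ ϑ θ 0‖ / 2)) := by ring
      _ ≤ (W * ((4 * (b - a) / κ + 2 * (NT * (4 / d₁))) * (κ / 2) +
          2 * (12 * NT / Real.sqrt (w * (bandBounds (show (-4 : ℝ) < -1.1 by norm_num) (show (-1.1 : ℝ) ≤ -0.1 by norm_num) (show (-0.1 : ℝ) < 0 by norm_num)).umin ^ 2)) * Real.sqrt (κ / 2) + (b - a) * log⁺ (hi / (κ / 2)))) + (W * (2 * (b - a) + 2 * (NC * c₀ / c₁))) + (W * (b - a)) * log⁺ ((π * hi / (c₀ * (bandBounds (show (-4 : ℝ) < -1.1 by norm_num) (show (-1.1 : ℝ) ≤ -0.1 by norm_num) (show (-0.1 : ℝ) < 0 by norm_num)).umin)) / torusDist (ϑ - π)) := by linarith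
  · -- NON-COOPER CLASS (part 5)
    push Not at hsle
    have hC : ∀ m : Fin 2 → ℤ, ((msD A₃ A₄ 1 *
            ((π / 2 * d₁ /
                  (((bandBounds (show (-4 : ℝ) < -1.1 by norm_num) (show (-1.1 : ℝ) ≤ -0.1 by norm_num) (show (-0.1 : ℝ) < 0 by norm_num)).Dtmin -
                      2 * A) *
                    (bandBounds (show (-4 : ℝ) < -1.1 by norm_num) (show (-1.1 : ℝ) ≤ -0.1 by norm_num) (show (-0.1 : ℝ) < 0 by norm_num)).umin) +
                π * Kc * κ / ((bandBounds (show (-4 : ℝ) < -1.1 by norm_num) (show (-1.1 : ℝ) ≤ -0.1 by norm_num) (show (-0.1 : ℝ) < 0 by norm_num)).Dtmin - 2 * A) ^ 2) /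
              ((bandBounds (show (-4 : ℝ) < -1.1 by norm_num) (show (-1.1 : ℝ) ≤ -0.1 by norm_num) (show (-0.1 : ℝ) < 0 by norm_num)).umin * w /
                (4 + 2 * A)))) +
          κ / ((bandBounds (show (-4 : ℝ) < -1.1 by norm_num) (show (-1.1 : ℝ) ≤ -0.1 by norm_num) (show (-0.1 : ℝ) < 0 by norm_num)).Dtmin - 2 * A)) <
        ‖pairSumPath μ K ρ ϑ θ 0 - WithLp.toLp 2 (fun i => 2 * π * (m i : ℝ))‖ := by
      intro m
      by_cases hm : m = 0
      · have hv0 : (WithLp.toLp 2 (fun i => 2 * π * (m i : ℝ)) : Momentum) = 0 := by ext i; simp [hm]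
        rw [hv0, sub_zero]
        linarith
      · have h := norm_pairSum_sub_twoPi_gt hA hr hlo hhi hρ ϑ θ hm
        linarith
    have hT := level_loop_partnerBand_le_nonCooper hA hA20 hd hlo hhi hA₃ hA₄ hK₁ hK₂ hK₃ hG hK₁0 (ρ := ρ) (ϑ := ϑ) (θ := θ) (t := t) (wt := wt)
      hab hlo0 hlohi hhir₀ hhirT hκ hd₁ hC hsmall hNT hNT' ht hW hw0 hw
    have hlog0 := hposlog ((π * hi / (c₀ * (bandBounds (show (-4 : ℝ) < -1.1 by norm_num) (show (-1.1 : ℝ) ≤ -0.1 by norm_num) (show (-0.1 : ℝ) < 0 by norm_num)).umin)) / torusDist (ϑ - π))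
    calc (∫ e in lo..hi, wt e * ∫ x in Icc a b, (max (t e) |frameLevel μ K (pairSumPath μ K ρ ϑ θ 0 - levelPoint μ K e (x + θ))|)⁻¹) ≤ (W * ((4 * (b - a) / κ + 2 * (NT * (4 / d₁))) * (κ / 2) +
          2 * (12 * NT / Real.sqrt (w * (bandBounds (show (-4 : ℝ) < -1.1 by norm_num) (show (-1.1 : ℝ) ≤ -0.1 by norm_num) (show (-0.1 : ℝ) < 0 by norm_num)).umin ^ 2)) * Real.sqrt (κ / 2) + (b - a) * log⁺ (hi / (κ / 2)))) := hT
      _ ≤ (W * ((4 * (b - a) / κ + 2 * (NT * (4 / d₁))) * (κ / 2) +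
          2 * (12 * NT / Real.sqrt (w * (bandBounds (show (-4 : ℝ) < -1.1 by norm_num) (show (-1.1 : ℝ) ≤ -0.1 by norm_num) (show (-0.1 : ℝ) < 0 by norm_num)).umin ^ 2)) * Real.sqrt (κ / 2) + (b - a) * log⁺ (hi / (κ / 2)))) + (W * (2 * (b - a) + 2 * (NC * c₀ / c₁))) + (W * (b - a)) * log⁺ ((π * hi / (c₀ * (bandBounds (show (-4 : ℝ) < -1.1 by norm_num) (show (-1.1 : ℝ) ≤ -0.1 by norm_num) (show (-0.1 : ℝ) < 0 by norm_num)).umin)) / torusDist (ϑ - π)) := by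
          have := mul_nonneg hP0 hlog0
          linarith

/-- **THE θ-FREE POINTWISE DOMINATOR (ph)**: for every tube angle with `‖ϑ‖_𝕋 > 0` (the forward configuration is the ph Cooper point),
`F_ph(ϑ;ρ,θ) ≤ K_T + K_C + W(b−a)·log⁺((πhi/(ĉ₀u_min))/‖ϑ‖_𝕋)`. -/
theorem absBubble_partnerBand_ph_le_posLog {Kc r₀ g₀ w : ℝ} (hG : GeomConstants (frameLevel μ K) Kc r₀ g₀ w) (hK₁0 : 0 < K₁) (hK₂0 : 0 < K₂)
    {ρ θ a b lo hi W c₀ c₁ sC d₁ κ : ℝ} {t wt : ℝ → ℝ} {NC NT : ℕ} (hρ : |ρ| < r)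
    (hab : a ≤ b) (hlo0 : 0 < lo) (hlohi : lo ≤ hi) (hhir₀ : hi < r₀)
    (hc₀ : 0 < c₀) (hc₁ : 0 < c₁)
    (hX : ((msD A₃ A₄ 1 *
            ((π / 2 * c₁ /
                  (((bandBounds (show (-4 : ℝ) < -1.1 by norm_num) (show (-1.1 : ℝ) ≤ -0.1 by norm_num) (show (-0.1 : ℝ) < 0 by norm_num)).Dtmin -
                      2 * A) *
                    (bandBounds (show (-4 : ℝ) < -1.1 by norm_num) (show (-1.1 : ℝ) ≤ -0.1 by norm_num) (show (-0.1 : ℝ) < 0 by norm_num)).umin) +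
                π * Kc * c₀ / ((bandBounds (show (-4 : ℝ) < -1.1 by norm_num) (show (-1.1 : ℝ) ≤ -0.1 by norm_num) (show (-0.1 : ℝ) < 0 by norm_num)).Dtmin - 2 * A) ^ 2) /
              ((bandBounds (show (-4 : ℝ) < -1.1 by norm_num) (show (-1.1 : ℝ) ≤ -0.1 by norm_num) (show (-0.1 : ℝ) < 0 by norm_num)).umin * w /
                (4 + 2 * A)))) +
          c₀ / ((bandBounds (show (-4 : ℝ) < -1.1 by norm_num) (show (-1.1 : ℝ) ≤ -0.1 by norm_num) (show (-0.1 : ℝ) < 0 by norm_num)).Dtmin - 2 * A)) < 1)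
    (hwinC : sC * ((msD A₃ A₄ 1 *
            ((π / 2 * c₁ /
                  (((bandBounds (show (-4 : ℝ) < -1.1 by norm_num) (show (-1.1 : ℝ) ≤ -0.1 by norm_num) (show (-0.1 : ℝ) < 0 by norm_num)).Dtmin -
                      2 * A) *
                    (bandBounds (show (-4 : ℝ) < -1.1 by norm_num) (show (-1.1 : ℝ) ≤ -0.1 by norm_num) (show (-0.1 : ℝ) < 0 by norm_num)).umin) +
                π * Kc * c₀ / ((bandBounds (show (-4 : ℝ) < -1.1 by norm_num) (show (-1.1 : ℝ) ≤ -0.1 by norm_num) (show (-0.1 : ℝ) < 0 by norm_num)).Dtmin - 2 * A) ^ 2) /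
              ((bandBounds (show (-4 : ℝ) < -1.1 by norm_num) (show (-1.1 : ℝ) ≤ -0.1 by norm_num) (show (-0.1 : ℝ) < 0 by norm_num)).umin * w /
                (4 + 2 * A)))) +
          c₀ / ((bandBounds (show (-4 : ℝ) < -1.1 by norm_num) (show (-1.1 : ℝ) ≤ -0.1 by norm_num) (show (-0.1 : ℝ) < 0 by norm_num)).Dtmin - 2 * A)) +
          2 * hi / ((bandBounds (show (-4 : ℝ) < -1.1 by norm_num) (show (-1.1 : ℝ) ≤ -0.1 by norm_num) (show (-0.1 : ℝ) < 0 by norm_num)).Dtmin - 2 * A) + sC < 3 / 5)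
    (hwinC' : sC * ((msD A₃ A₄ 1 *
            ((π / 2 * c₁ /
                  (((bandBounds (show (-4 : ℝ) < -1.1 by norm_num) (show (-1.1 : ℝ) ≤ -0.1 by norm_num) (show (-0.1 : ℝ) < 0 by norm_num)).Dtmin -
                      2 * A) *
                    (bandBounds (show (-4 : ℝ) < -1.1 by norm_num) (show (-1.1 : ℝ) ≤ -0.1 by norm_num) (show (-0.1 : ℝ) < 0 by norm_num)).umin) +
                π * Kc * c₀ / ((bandBounds (show (-4 : ℝ) < -1.1 by norm_num) (show (-1.1 : ℝ) ≤ -0.1 by norm_num) (show (-0.1 : ℝ) < 0 by norm_num)).Dtmin - 2 * A) ^ 2) /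
              ((bandBounds (show (-4 : ℝ) < -1.1 by norm_num) (show (-1.1 : ℝ) ≤ -0.1 by norm_num) (show (-0.1 : ℝ) < 0 by norm_num)).umin * w /
                (4 + 2 * A)))) +
          c₀ / ((bandBounds (show (-4 : ℝ) < -1.1 by norm_num) (show (-1.1 : ℝ) ≤ -0.1 by norm_num) (show (-0.1 : ℝ) < 0 by norm_num)).Dtmin - 2 * A)) +
          2 * hi / ((bandBounds (show (-4 : ℝ) < -1.1 by norm_num) (show (-1.1 : ℝ) ≤ -0.1 by norm_num) (show (-0.1 : ℝ) < 0 by norm_num)).Dtmin - 2 * A) + sC <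
        2 * (bandBounds (show (-4 : ℝ) < -1.1 by norm_num) (show (-1.1 : ℝ) ≤ -0.1 by norm_num) (show (-0.1 : ℝ) < 0 by norm_num)).umin)
    (hhirC : hi + c₀ * sC < r) (hNC : (b - a) * (4 * (K₂ * msD A₃ A₄ 1)) ≤ NC * c₀)
    (hd₁ : 0 < d₁) (hκ : 0 < κ)
    (hs₀ : ((msD A₃ A₄ 1 *
            ((π / 2 * d₁ /
                  (((bandBounds (show (-4 : ℝ) < -1.1 by norm_num) (show (-1.1 : ℝ) ≤ -0.1 by norm_num) (show (-0.1 : ℝ) < 0 by norm_num)).Dtmin -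
                      2 * A) *
                    (bandBounds (show (-4 : ℝ) < -1.1 by norm_num) (show (-1.1 : ℝ) ≤ -0.1 by norm_num) (show (-0.1 : ℝ) < 0 by norm_num)).umin) +
                π * Kc * κ / ((bandBounds (show (-4 : ℝ) < -1.1 by norm_num) (show (-1.1 : ℝ) ≤ -0.1 by norm_num) (show (-0.1 : ℝ) < 0 by norm_num)).Dtmin - 2 * A) ^ 2) /
              ((bandBounds (show (-4 : ℝ) < -1.1 by norm_num) (show (-1.1 : ℝ) ≤ -0.1 by norm_num) (show (-0.1 : ℝ) < 0 by norm_num)).umin * w /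
                (4 + 2 * A)))) +
          κ / ((bandBounds (show (-4 : ℝ) < -1.1 by norm_num) (show (-1.1 : ℝ) ≤ -0.1 by norm_num) (show (-0.1 : ℝ) < 0 by norm_num)).Dtmin - 2 * A)) ≤ sC)
    (hs₀' : ((msD A₃ A₄ 1 *
            ((π / 2 * d₁ /
                  (((bandBounds (show (-4 : ℝ) < -1.1 by norm_num) (show (-1.1 : ℝ) ≤ -0.1 by norm_num) (show (-0.1 : ℝ) < 0 by norm_num)).Dtmin -
                      2 * A) *
                    (bandBounds (show (-4 : ℝ) < -1.1 by norm_num) (show (-1.1 : ℝ) ≤ -0.1 by norm_num) (show (-0.1 : ℝ) < 0 by norm_num)).umin) +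
                π * Kc * κ / ((bandBounds (show (-4 : ℝ) < -1.1 by norm_num) (show (-1.1 : ℝ) ≤ -0.1 by norm_num) (show (-0.1 : ℝ) < 0 by norm_num)).Dtmin - 2 * A) ^ 2) /
              ((bandBounds (show (-4 : ℝ) < -1.1 by norm_num) (show (-1.1 : ℝ) ≤ -0.1 by norm_num) (show (-0.1 : ℝ) < 0 by norm_num)).umin * w /
                (4 + 2 * A)))) +
          κ / ((bandBounds (show (-4 : ℝ) < -1.1 by norm_num) (show (-1.1 : ℝ) ≤ -0.1 by norm_num) (show (-0.1 : ℝ) < 0 by norm_num)).Dtmin - 2 * A)) ≤ 3 / 5)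
    (hhirT : hi + κ < r)
    (hsmall :
        K₃ * ((msD A₃ A₄ 1 *
            ((π / 2 * d₁ /
                  (((bandBounds (show (-4 : ℝ) < -1.1 by norm_num) (show (-1.1 : ℝ) ≤ -0.1 by norm_num) (show (-0.1 : ℝ) < 0 by norm_num)).Dtmin -
                      2 * A) *
                    (bandBounds (show (-4 : ℝ) < -1.1 by norm_num) (show (-1.1 : ℝ) ≤ -0.1 by norm_num) (show (-0.1 : ℝ) < 0 by norm_num)).umin) +
                π * Kc * κ / ((bandBounds (show (-4 : ℝ) < -1.1 by norm_num) (show (-1.1 : ℝ) ≤ -0.1 by norm_num) (show (-0.1 : ℝ) < 0 by norm_num)).Dtmin - 2 * A) ^ 2) /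
              ((bandBounds (show (-4 : ℝ) < -1.1 by norm_num) (show (-1.1 : ℝ) ≤ -0.1 by norm_num) (show (-0.1 : ℝ) < 0 by norm_num)).umin * w /
                (4 + 2 * A)))) +
          (2 * hi + κ) / ((bandBounds (show (-4 : ℝ) < -1.1 by norm_num) (show (-1.1 : ℝ) ≤ -0.1 by norm_num) (show (-0.1 : ℝ) < 0 by norm_num)).Dtmin - 2 * A) +
              hi / ((bandBounds (show (-4 : ℝ) < -1.1 by norm_num) (show (-1.1 : ℝ) ≤ -0.1 by norm_num) (show (-0.1 : ℝ) < 0 by norm_num)).Dtmin - 2 * A)) *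
            msD A₃ A₄ 1 ^ 2 +
          K₂ * (radialRowOneConst A ((bandBounds (show (-4 : ℝ) < -1.1 by norm_num) (show (-1.1 : ℝ) ≤ -0.1 by norm_num) (show (-0.1 : ℝ) < 0 by norm_num)).Dtmin -
                2 * A) * hi) * (msD A₃ A₄ 1 + msD A₃ A₄ 1) +
          K₂ * ((msD A₃ A₄ 1 *
            ((π / 2 * d₁ /
                  (((bandBounds (show (-4 : ℝ) < -1.1 by norm_num) (show (-1.1 : ℝ) ≤ -0.1 by norm_num) (show (-0.1 : ℝ) < 0 by norm_num)).Dtmin -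
                      2 * A) *
                    (bandBounds (show (-4 : ℝ) < -1.1 by norm_num) (show (-1.1 : ℝ) ≤ -0.1 by norm_num) (show (-0.1 : ℝ) < 0 by norm_num)).umin) +
                π * Kc * κ / ((bandBounds (show (-4 : ℝ) < -1.1 by norm_num) (show (-1.1 : ℝ) ≤ -0.1 by norm_num) (show (-0.1 : ℝ) < 0 by norm_num)).Dtmin - 2 * A) ^ 2) /
              ((bandBounds (show (-4 : ℝ) < -1.1 by norm_num) (show (-1.1 : ℝ) ≤ -0.1 by norm_num) (show (-0.1 : ℝ) < 0 by norm_num)).umin * w /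
                (4 + 2 * A)))) +
          (2 * hi + κ) / ((bandBounds (show (-4 : ℝ) < -1.1 by norm_num) (show (-1.1 : ℝ) ≤ -0.1 by norm_num) (show (-0.1 : ℝ) < 0 by norm_num)).Dtmin - 2 * A) +
              hi / ((bandBounds (show (-4 : ℝ) < -1.1 by norm_num) (show (-1.1 : ℝ) ≤ -0.1 by norm_num) (show (-0.1 : ℝ) < 0 by norm_num)).Dtmin - 2 * A)) *
            msD A₃ A₄ 2 +
          K₁ * ((uRowTwoConst A A₃ ((bandBounds (show (-4 : ℝ) < -1.1 by norm_num) (show (-1.1 : ℝ) ≤ -0.1 by norm_num) (show (-0.1 : ℝ) < 0 by norm_num)).Dtmin -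
                  2 * A) +
                1 / ((bandBounds (show (-4 : ℝ) < -1.1 by norm_num) (show (-1.1 : ℝ) ≤ -0.1 by norm_num) (show (-0.1 : ℝ) < 0 by norm_num)).Dtmin - 2 * A) +
                2 * (radialRowOneConst A ((bandBounds (show (-4 : ℝ) < -1.1 by norm_num) (show (-1.1 : ℝ) ≤ -0.1 by norm_num) (show (-0.1 : ℝ) < 0 by norm_num)).Dtmin - 2 * A) -
                  1 / ((bandBounds (show (-4 : ℝ) < -1.1 by norm_num) (show (-1.1 : ℝ) ≤ -0.1 by norm_num) (show (-0.1 : ℝ) < 0 by norm_num)).Dtmin - 2 * A))) *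
              hi) ≤
        w * (bandBounds (show (-4 : ℝ) < -1.1 by norm_num) (show (-1.1 : ℝ) ≤ -0.1 by norm_num) (show (-0.1 : ℝ) < 0 by norm_num)).umin ^ 2)
    (hNT : (b - a) * (4 * (K₁ * msD A₃ A₄ 1)) ≤ NT * κ) (hNT' : (b - a) * (4 * (K₂ * msD A₃ A₄ 1 ^ 2 + K₁ * msD A₃ A₄ 2)) ≤ NT * d₁)
    (ht : ∀ e ∈ Icc lo hi, e ≤ t e) (hW : 0 ≤ W) (hw0 : ∀ e ∈ Icc lo hi, 0 ≤ wt e) (hw : ∀ e ∈ Icc lo hi, wt e ≤ W)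
    {ϑ : ℝ} (hϑ : 0 < torusDist ϑ) :
    (∫ e in lo..hi, wt e * ∫ x in Icc a b, (max (t e) |frameLevel μ K (levelPoint μ K e (x + θ) - pairDiffPath μ K ρ ϑ θ 0)|)⁻¹) ≤
      (W * ((4 * (b - a) / κ + 2 * (NT * (4 / d₁))) * (κ / 2) +
          2 * (12 * NT / Real.sqrt (w * (bandBounds (show (-4 : ℝ) < -1.1 by norm_num) (show (-1.1 : ℝ) ≤ -0.1 by norm_num) (show (-0.1 : ℝ) < 0 by norm_num)).umin ^ 2)) * Real.sqrt (κ / 2) + (b - a) * log⁺ (hi / (κ / 2)))) + (W * (2 * (b - a) + 2 * (NC * c₀ / c₁))) +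
        (W * (b - a)) * log⁺ ((π * hi / (c₀ * (bandBounds (show (-4 : ℝ) < -1.1 by norm_num) (show (-1.1 : ℝ) ≤ -0.1 by norm_num) (show (-0.1 : ℝ) < 0 by norm_num)).umin)) / torusDist ϑ) := by
  simp only [partnerBand_ph_eq_pp_sub_pi]
  have hϑ' : 0 < torusDist (ϑ - π - π) := by rwa [torusDist_sub_pi_sub_pi]
  have h := absBubble_partnerBand_le_posLog hA hA20 hd hr hlo hhi hA₃ hA₄ hK₁ hK₂ hK₃ hG hK₁0 hK₂0 (ϑ := ϑ - π) (θ := θ) (t := t) (wt := wt)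
    hρ hab hlo0 hlohi hhir₀ hc₀ hc₁ hX hwinC hwinC' hhirC hNC hd₁ hκ hs₀ hs₀' hhirT hsmall hNT hNT' ht hW hw0 hw hϑ'
  rw [torusDist_sub_pi_sub_pi] at h
  exact h

end Sizes

end Summit.HubbardSuperconductivity.HubbardSuperconductivity.Theorems.C4a

end
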